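import Summits.CriticalPhenomena.PercolationContinuityZ3.Theorems.PercNearOneGluingNoHeavyLowerTailCILTwoSteinerSeriesTools
import HarnessLib

/-!
# `NoHeavyLowerTail` (stmt-CriticalPhenomena-4575) — the OBSERVER SERIES LAW in modular form:
# CIL at an observer with two non-relay neighbours from CIL at those neighbours in the series-reduced graph

Support file (prover `prim-hp-2`, deletion–contraction / pivotal-edge line; `--supports stmt-CriticalPhenomena-4575`).
No definitions/named facts/sorries.  Notation as in `…CILTwoSteinerSeriesTools.lean` (`w₃` = the series-reduced graph of `o`).

* `CILTwoSteiner.series_base_le` — THE OBSERVER SERIES LAW: if the positive pairs at `o` go to `x ≠ y` only and, in `w₃`,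
  CIL holds at the observers `x` and `y` with witness `c`, then `μ_w(L_o) ≤ μ_w(R_c)`.  Mechanism:
  `μ_w(L_o) = α(1−β)·μ_{w⁰}(L_x) + (1−α)β·μ_{w⁰}(L_y) + αβ·M` is bilinear in `(α,β) = (w(ox), w(oy))`,
  `μ_{w₃}(L_x) = (1−αβ)·μ_{w⁰}(L_x) + αβ·M` (same for `y`, same `M = μ_{w⁰[g↦1]}(L_x)`), `μ_w(R_c) = μ_{w₃}(R_c)`, and
  `α(1−β) + (1−α)β ≤ 1 − αβ`: a degree-two observer is a series link, and sliding its two weights to `(1, αβ)` / `(αβ, 1)`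
  keeps the relay law (hence the champion) and does not decrease `μ(L_o)`; other classes plug into the modular step.
* `cil_twoSteiner_of` — THE MODULAR STEP: the positive-weight neighbours of `o ∉ A` are relays and the two non-relays
  `x ≠ y`, which are otherwise ARBITRARY (further neighbours of any kind; `x–y` may be a pair).  If CIL holds in `w₃` at `x`
  and at `y` for every champion of `w₃`, then CIL holds at `o` in `w` for every champion of `w`, at the same level (relay pairs
  at `o` peeled by `CILOneSteiner.mergeStability_at_relay` with a champion of the deleted graph, as in `cil_oneSteiner_of`).
* `cil_twoSteiner_adj`, `cil_twoSteiner_adj_exists` — corollary: `x`, `y` pendant relay-stars that MAY be joined to each other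
  (`cil_oneSteiner` at `x` and at `y` in `w₃`); with `w s(x,y) = 0` this is `cil_twoSteiner` (`…CILTwoSteiner.lean`) by a second route.
-/

noncomputable section

namespace Summit.CriticalPhenomena.PercolationContinuityZ3.Theorems

open MeasureTheory Set Literature.Probability.LatticeModels Literature.Probability.Percolation
open scoped Classical BigOperators

variable {n : ℕ}

namespace CILTwoSteiner

open CILOneSteiner ChampionStability MergeStability RelayNbhd


/-- **The observer series law.**  `o ∉ A`, the positive pairs at `o` go to `x ≠ y` (both `≠ o`) only, `w₃` is the
series-reduced graph, `c ∈ A`.  If CIL holds in `w₃` at the observers `x` and `y` with witness `c` —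
`μ_{w₃}(L_x) ≤ μ_{w₃}(R_c)` and `μ_{w₃}(L_y) ≤ μ_{w₃}(R_c)` — then `μ_w(L_o) ≤ μ_w(R_c)`.
Proof: `μ_w(L_o) = α(1−β)μ_{w⁰}(L_x) + (1−α)βμ_{w⁰}(L_y) + αβμ_{w⁰[g↦1]}(L_x)`, `μ_{w₃}(L_x) = (1−αβ)μ_{w⁰}(L_x) + αβμ_{w⁰[g↦1]}(L_x)`
(same for `y`), `μ_w(R_c) = μ_{w₃}(R_c)` (`HullPort.series_reduction`), and `α(1−β) + (1−α)β ≤ 1 − αβ`.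
[cite: KozmaNitzan2024, §3 (pp. 12–13) — setting; the series law is folklore] -/
theorem series_base_le (w w₃ : Sym2 (Fin n) → unitInterval) (A : Finset (Fin n)) (o x y : Fin n) (j : ℕ)
    (ho : o ∉ A) (hxo : x ≠ o) (hyo : y ≠ o) (hxy : x ≠ y)
    (hiso : ∀ v : Fin n, v ≠ o → v ≠ x → v ≠ y → (w s(o, v) : ℝ) = 0)
    (h₃z : ∀ v : Fin n, v ≠ o → w₃ s(o, v) = 0) (h₃zz : w₃ s(o, o) = w s(o, o))
    (h₃off : ∀ e : Sym2 (Fin n), o ∉ e → e ≠ s(x, y) → w₃ e = w e)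
    (h₃xy : (w₃ s(x, y) : ℝ) = 1 - (1 - (w s(x, y) : ℝ)) * (1 - (w s(o, x) : ℝ) * w s(o, y)))
    (c : Fin n) (hc : c ∈ A)
    (hHx : (prodBernoulli w₃).real {ω : BondConfig (Fin n) |
        1 ≤ (A.filter fun z => ω ∈ openConn x z).card ∧ (A.filter fun z => ω ∈ openConn x z).card ≤ j} ≤
      (prodBernoulli w₃).real {ω : BondConfig (Fin n) | (A.filter fun z => ω ∈ openConn c z).card ≤ j})
    (hHy : (prodBernoulli w₃).real {ω : BondConfig (Fin n) |
        1 ≤ (A.filter fun z => ω ∈ openConn y z).card ∧ (A.filter fun z => ω ∈ openConn y z).card ≤ j} ≤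
      (prodBernoulli w₃).real {ω : BondConfig (Fin n) | (A.filter fun z => ω ∈ openConn c z).card ≤ j}) :
    (prodBernoulli w).real {ω : BondConfig (Fin n) |
        1 ≤ (A.filter fun z => ω ∈ openConn o z).card ∧ (A.filter fun z => ω ∈ openConn o z).card ≤ j} ≤
      (prodBernoulli w).real {ω : BondConfig (Fin n) | (A.filter fun z => ω ∈ openConn c z).card ≤ j} := by
  haveI : ∀ u : Sym2 (Fin n) → unitInterval, IsProbabilityMeasure (prodBernoulli u) := fun u => inferInstance
  have hox : o ≠ x := fun h => hxo h.symm
  have hoy : o ≠ y := fun h => hyo h.symm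
  have hyx : y ≠ x := fun h => hxy h.symm
  have hco : c ≠ o := fun h => ho (h ▸ hc)
  set w0 : Sym2 (Fin n) → unitInterval := pinW w {e : Sym2 (Fin n) | o ∈ e ∧ ¬ e.IsDiag} ∅ with hw0
  set e : Sym2 (Fin n) := s(o, x) with he
  set f : Sym2 (Fin n) := s(o, y) with hf
  set g : Sym2 (Fin n) := s(x, y) with hg
  have hef : e ≠ f := by rw [he, hf]; intro h; exact hxy (Sym2.congr_right.1 h)
  have hfe : f ≠ e := fun h => hef h.symm
  have hw0e : w0 e = 0 := by rw [hw0, he]; exact pinW_star_mk w hxo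
  have hw0f : w0 f = 0 := by rw [hw0, hf]; exact pinW_star_mk w hyo
  -- (1) `w` is `G − o` with the two pairs restored
  have hw : w = Function.update (Function.update w0 e (w e)) f (w f) := by
    funext e'
    by_cases h1 : e' = f
    · rw [h1, Function.update_self]
    · rw [Function.update_of_ne h1]
      by_cases h2 : e' = e
      · rw [h2, Function.update_self]
      · rw [Function.update_of_ne h2]
        by_cases hmem : e' ∈ {e : Sym2 (Fin n) | o ∈ e ∧ ¬ e.IsDiag}
        · obtain ⟨hoe, hdiag⟩ := hmem
          obtain ⟨v, rfl⟩ : ∃ v, e' = s(o, v) := by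
            induction e' using Sym2.ind with
            | h a b =>
              rcases Sym2.mem_iff.1 hoe with rfl | rfl
              · exact ⟨b, rfl⟩
              · exact ⟨a, Sym2.eq_swap⟩
          have hvo : v ≠ o := by
            intro h; apply hdiag; rw [h]; exact Sym2.mk_isDiag_iff.2 rfl
          have hvx : v ≠ x := by intro h; apply h2; rw [h, he]
          have hvy : v ≠ y := by intro h; apply h1; rw [h, hf]
          rw [hw0, pinW_star_mk w hvo]
          exact Subtype.ext (hiso v hvo hvx hvy)
        · rw [hw0, pinW_apply_of_not_mem w ∅ hmem]
  -- (2) corner weight functions and the bilinear expansion of `μ_w(L_o)`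
  have hu_e0 : Function.update w0 e 0 = w0 := Function.update_eq_self_iff.2 hw0e.symm
  have hu_f0 : Function.update w0 f 0 = w0 := Function.update_eq_self_iff.2 hw0f.symm
  have c00 : Function.update (Function.update w0 e 0) f 0 = w0 := by rw [hu_e0, hu_f0]
  have c10 : Function.update (Function.update w0 e 1) f 0 = Function.update w0 e 1 := by
    rw [Function.update_eq_self_iff, Function.update_of_ne hfe]; exact hw0f.symm
  have c01 : Function.update (Function.update w0 e 0) f 1 = Function.update w0 f 1 := by rw [hu_e0]
  set Lo : Set (BondConfig (Fin n)) := {ω : BondConfig (Fin n) |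
      1 ≤ (A.filter fun z => ω ∈ openConn o z).card ∧ (A.filter fun z => ω ∈ openConn o z).card ≤ j} with hLo
  set Lx : Set (BondConfig (Fin n)) := {ω : BondConfig (Fin n) |
      1 ≤ (A.filter fun z => ω ∈ openConn x z).card ∧ (A.filter fun z => ω ∈ openConn x z).card ≤ j} with hLx
  set Ly : Set (BondConfig (Fin n)) := {ω : BondConfig (Fin n) |
      1 ≤ (A.filter fun z => ω ∈ openConn y z).card ∧ (A.filter fun z => ω ∈ openConn y z).card ≤ j} with hLy
  set Rc : Set (BondConfig (Fin n)) := {ω : BondConfig (Fin n) | (A.filter fun z => ω ∈ openConn c z).card ≤ j}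
    with hRc
  set α : ℝ := (w e : ℝ) with hα
  set β : ℝ := (w f : ℝ) with hβ
  have hα0 : 0 ≤ α := (w e).2.1
  have hα1 : α ≤ 1 := (w e).2.2
  have hβ0 : 0 ≤ β := (w f).2.1
  have hβ1 : β ≤ 1 := (w f).2.2
  set LX : ℝ := (prodBernoulli w0).real Lx with hLX
  set LY : ℝ := (prodBernoulli w0).real Ly with hLY
  set M : ℝ := (prodBernoulli (Function.update w0 g 1)).real Lx with hM
  have hLXn : 0 ≤ LX := measureReal_nonneg
  have hLYn : 0 ≤ LY := measureReal_nonneg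
  have hL00 : (prodBernoulli w0).real Lo = 0 := by
    rw [hLo]
    refine real_L_eq_zero_of_isolated w0 A o j ho fun v hv => ?_
    rw [hw0, pinW_star_mk w hv]; rfl
  have hL10 : (prodBernoulli (Function.update w0 e 1)).real Lo = LX := by
    rw [hLo, hLX, hLx, hw0, he]; exact real_L_update_wzero_one w A o x j ho hxo
  have hL01 : (prodBernoulli (Function.update w0 f 1)).real Lo = LY := by
    rw [hLo, hLY, hLy, hw0, hf]; exact real_L_update_wzero_one w A o y j ho hyo
  have hL11 : (prodBernoulli (Function.update (Function.update w0 e 1) f 1)).real Lo = M := by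
    rw [hLo, hM, hLx, hw0, he, hf, hg]; exact real_L_update_wzero_one_one w A o x y j ho hxo hyo hxy
  have hL11' : (prodBernoulli (Function.update w0 g 1)).real Ly = M := by
    have h := real_L_update_wzero_one_one w A o y x j ho hyo hxo hyx
    rw [← hw0, ← he, ← hf, Function.update_comm hfe, ← hLo, hL11, Sym2.eq_swap, ← hg, ← hLy] at h
    exact h.symm
  have hLexp : (prodBernoulli w).real Lo = α * (1 - β) * LX + (1 - α) * β * LY + α * β * M := by
    have h := tieLiftTwo_twoBond_decomp w0 hef (w e) (w f) Lo
    rw [← hw, c00, c10, c01, hL00, hL10, hL01, hL11] at h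
    rw [h]; ring
  -- (3) the series-reduced graph: `L_x`, `L_y` and the relay law
  have h3 := real_seriesReduced w w₃ o x y h₃z h₃zz h₃off h₃xy hox hoy
  have h3x : (prodBernoulli w₃).real Lx = (1 - α * β) * LX + α * β * M := by
    rw [h3 Lx, ← hw0, ← hg]
  have h3y : (prodBernoulli w₃).real Ly = (1 - α * β) * LY + α * β * M := by
    rw [h3 Ly, ← hw0, ← hg, hL11']
  have hiso' : ∀ v : Fin n, v ≠ o → v ≠ x → v ≠ y → w s(o, v) = 0 :=
    fun v hvo hvx hvy => Subtype.ext (hiso v hvo hvx hvy)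
  have hRser : (prodBernoulli w).real Rc = (prodBernoulli w₃).real Rc := by
    rw [hRc]
    exact HullPort.series_reduction w w₃ A o x y ho hox hoy hxy hiso' h₃z h₃zz h₃off h₃xy c hco
      (fun F => F.card ≤ j)
  -- (4) assembly
  have hkey : α * (1 - β) + (1 - α) * β ≤ 1 - α * β := by
    nlinarith [mul_nonneg (sub_nonneg.2 hα1) (sub_nonneg.2 hβ1)]
  rw [hLexp, hRser]
  rw [h3x] at hHx
  rw [h3y] at hHy
  rcases le_total LX LY with h | h
  · have s1 : α * (1 - β) * LX ≤ α * (1 - β) * LY :=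
      mul_le_mul_of_nonneg_left h (mul_nonneg hα0 (sub_nonneg.2 hβ1))
    have s2 : (α * (1 - β) + (1 - α) * β) * LY ≤ (1 - α * β) * LY :=
      mul_le_mul_of_nonneg_right hkey hLYn
    nlinarith [s1, s2, hHy]
  · have s1 : (1 - α) * β * LY ≤ (1 - α) * β * LX :=
      mul_le_mul_of_nonneg_left h (mul_nonneg (sub_nonneg.2 hα1) hβ0)
    have s2 : (α * (1 - β) + (1 - α) * β) * LX ≤ (1 - α * β) * LX :=
      mul_le_mul_of_nonneg_right hkey hLXn
    nlinarith [s1, s2, hHx]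

end CILTwoSteiner

open CILOneSteiner ChampionStability MergeStability RelayNbhd CILTwoSteiner

/-- **THE MODULAR TWO-STEINER STEP.**  `o ∉ A`; `x ≠ y` non-relays `≠ o`; every positive-weight neighbour of `o` other
than `x, y` is a relay (`x`, `y` are otherwise ARBITRARY — further neighbours of any kind, and `x–y` may be a pair); `w₃`
the series-reduced graph of `o` (pairs at `o` closed, `x–y` raised to `1 − (1 − w(xy))(1 − w(ox)w(oy))`).  If in `w₃` CIL
holds at the observer `x` and at the observer `y` with every champion of `w₃` as witness, then CIL holds at `o` in `w` with
every champion of `w` as witness, at the same level.  Induction on the relay pairs at `o` (`mergeStability_at_relay` for the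
glued branch, a champion of the deleted graph for the other); base `CILTwoSteiner.series_base_le`.
[cite: VandenbergHaggstromKahn2005, Thm. 1.5 (p. 7) — via `mergeStability_at_relay`] -/
theorem cil_twoSteiner_of (A : Finset (Fin n)) (o x y : Fin n) (j : ℕ) (ho : o ∉ A) (hx : x ∉ A) (hy : y ∉ A)
    (hxo : x ≠ o) (hyo : y ≠ o) (hxy : x ≠ y) (w₃ : Sym2 (Fin n) → unitInterval)
    (h₃z : ∀ v : Fin n, v ≠ o → w₃ s(o, v) = 0)
    (hHx : ∀ c' ∈ A, (∀ a ∈ A,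
        (prodBernoulli w₃).real {ω : BondConfig (Fin n) | (A.filter fun z => ω ∈ openConn a z).card ≤ j} ≤
          (prodBernoulli w₃).real {ω : BondConfig (Fin n) | (A.filter fun z => ω ∈ openConn c' z).card ≤ j}) →
      (prodBernoulli w₃).real {ω : BondConfig (Fin n) |
          1 ≤ (A.filter fun z => ω ∈ openConn x z).card ∧ (A.filter fun z => ω ∈ openConn x z).card ≤ j} ≤
        (prodBernoulli w₃).real {ω : BondConfig (Fin n) | (A.filter fun z => ω ∈ openConn c' z).card ≤ j})
    (hHy : ∀ c' ∈ A, (∀ a ∈ A,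
        (prodBernoulli w₃).real {ω : BondConfig (Fin n) | (A.filter fun z => ω ∈ openConn a z).card ≤ j} ≤
          (prodBernoulli w₃).real {ω : BondConfig (Fin n) | (A.filter fun z => ω ∈ openConn c' z).card ≤ j}) →
      (prodBernoulli w₃).real {ω : BondConfig (Fin n) |
          1 ≤ (A.filter fun z => ω ∈ openConn y z).card ∧ (A.filter fun z => ω ∈ openConn y z).card ≤ j} ≤
        (prodBernoulli w₃).real {ω : BondConfig (Fin n) | (A.filter fun z => ω ∈ openConn c' z).card ≤ j}) :
    ∀ (m : ℕ) (w : Sym2 (Fin n) → unitInterval),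
      (A.filter fun v => 0 < (w s(o, v) : ℝ)).card = m →
      (∀ v : Fin n, v ≠ o → v ∉ A → v ≠ x → v ≠ y → (w s(o, v) : ℝ) = 0) →
      w₃ s(o, o) = w s(o, o) →
      (∀ e : Sym2 (Fin n), o ∉ e → e ≠ s(x, y) → w₃ e = w e) →
      ((w₃ s(x, y) : ℝ) = 1 - (1 - (w s(x, y) : ℝ)) * (1 - (w s(o, x) : ℝ) * w s(o, y))) →
      ∀ c ∈ A, (∀ a ∈ A,
        (prodBernoulli w).real {ω : BondConfig (Fin n) | (A.filter fun z => ω ∈ openConn a z).card ≤ j} ≤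
          (prodBernoulli w).real {ω : BondConfig (Fin n) | (A.filter fun z => ω ∈ openConn c z).card ≤ j}) →
      (prodBernoulli w).real {ω : BondConfig (Fin n) |
          1 ≤ (A.filter fun z => ω ∈ openConn o z).card ∧ (A.filter fun z => ω ∈ openConn o z).card ≤ j} ≤
        (prodBernoulli w).real {ω : BondConfig (Fin n) | (A.filter fun z => ω ∈ openConn c z).card ≤ j} := by
  intro m
  induction m with
  | zero =>
    intro w hm hoN h₃zz h₃off h₃xy c hc hchampw
    have hrel0 : ∀ v ∈ A, (w s(o, v) : ℝ) = 0 := by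
      intro v hv
      by_contra hne
      have hpos : 0 < (w s(o, v) : ℝ) := lt_of_le_of_ne (w s(o, v)).2.1 (Ne.symm hne)
      have hmem : v ∈ (A.filter fun v => 0 < (w s(o, v) : ℝ)) := Finset.mem_filter.2 ⟨hv, hpos⟩
      rw [Finset.card_eq_zero] at hm
      rw [hm] at hmem
      exact Finset.notMem_empty v hmem
    have hiso : ∀ v : Fin n, v ≠ o → v ≠ x → v ≠ y → (w s(o, v) : ℝ) = 0 := by
      intro v hvo hvx hvy
      by_cases hvA : v ∈ A
      · exact hrel0 v hvA
      · exact hoN v hvo hvA hvx hvy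
    -- `c` is a champion of `w₃` (same relay law)
    have hchamp3 : ∀ a ∈ A,
        (prodBernoulli w₃).real {ω : BondConfig (Fin n) | (A.filter fun z => ω ∈ openConn a z).card ≤ j} ≤
          (prodBernoulli w₃).real {ω : BondConfig (Fin n) | (A.filter fun z => ω ∈ openConn c z).card ≤ j} := by
      intro a ha
      rw [← lightness_seriesReduced w w₃ A o x y j ho hxo hyo hxy hiso h₃z h₃zz h₃off h₃xy a ha,
        ← lightness_seriesReduced w w₃ A o x y j ho hxo hyo hxy hiso h₃z h₃zz h₃off h₃xy c hc]
      exact hchampw a ha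
    exact series_base_le w w₃ A o x y j ho hxo hyo hxy hiso h₃z h₃zz h₃off h₃xy c hc
      (hHx c hc hchamp3) (hHy c hc hchamp3)
  | succ m ih =>
    intro w hm hoN h₃zz h₃off h₃xy c hc hchampw
    obtain ⟨v, hv⟩ := Finset.card_pos.1 (by omega : 0 < (A.filter fun v => 0 < (w s(o, v) : ℝ)).card)
    obtain ⟨hvA, hvpos⟩ := Finset.mem_filter.1 hv
    have hvo : v ≠ o := fun h => ho (h ▸ hvA)
    have hvx : v ≠ x := fun h => hx (h ▸ hvA)
    have hvy : v ≠ y := fun h => hy (h ▸ hvA)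
    set e : Sym2 (Fin n) := s(o, v) with he
    set w₀ : Sym2 (Fin n) → unitInterval := Function.update w e 0 with hw₀
    set w₁ : Sym2 (Fin n) → unitInterval := Function.update w e 1 with hw₁
    have hcount : (A.filter fun u => 0 < (w₀ s(o, u) : ℝ)).card = m := by
      have hset : (A.filter fun u => 0 < (w₀ s(o, u) : ℝ)) = (A.filter fun u => 0 < (w s(o, u) : ℝ)).erase v := by
        ext u
        simp only [Finset.mem_filter, Finset.mem_erase]
        by_cases huv : u = v
        · subst huv
          simp [hw₀, he, hvA]
        · have hne : s(o, u) ≠ e := by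
            rw [he]
            intro h
            exact huv (Sym2.congr_right.1 h)
          simp [hw₀, Function.update_of_ne hne, huv]
      rw [hset, Finset.card_erase_of_mem hv, hm]
      rfl
    have hoN₀ : ∀ u : Fin n, u ≠ o → u ∉ A → u ≠ x → u ≠ y → (w₀ s(o, u) : ℝ) = 0 :=
      fun u hu huA hux huy => update_zero_apply_eq_zero w e _ (hoN u hu huA hux huy)
    -- the series-reduced graph is unchanged by closing a relay pair at `o`
    have hoo : s(o, o) ≠ e := by
      rw [he]; intro h; exact hvo (Sym2.congr_right.1 h).symm
    have h₃zz₀ : w₃ s(o, o) = w₀ s(o, o) := by rw [hw₀, Function.update_of_ne hoo]; exact h₃zz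
    have h₃off₀ : ∀ e' : Sym2 (Fin n), o ∉ e' → e' ≠ s(x, y) → w₃ e' = w₀ e' := by
      intro e' ho' hne
      have hne' : e' ≠ e := by
        rw [he]; intro h; apply ho'; rw [h]; exact Sym2.mem_mk_left o v
      rw [hw₀, Function.update_of_ne hne']
      exact h₃off e' ho' hne
    have hxy_ne : s(x, y) ≠ e := by
      rw [he]; intro h
      have : o ∈ s(x, y) := by rw [h]; exact Sym2.mem_mk_left o v
      rcases Sym2.mem_iff.1 this with h' | h'
      · exact hxo h'.symm
      · exact hyo h'.symm
    have hox_ne : s(o, x) ≠ e := by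
      rw [he]; intro h; exact hvx (Sym2.congr_right.1 h).symm
    have hoy_ne : s(o, y) ≠ e := by
      rw [he]; intro h; exact hvy (Sym2.congr_right.1 h).symm
    have h₃xy₀ : (w₃ s(x, y) : ℝ) = 1 - (1 - (w₀ s(x, y) : ℝ)) * (1 - (w₀ s(o, x) : ℝ) * w₀ s(o, y)) := by
      rw [hw₀, Function.update_of_ne hxy_ne, Function.update_of_ne hox_ne, Function.update_of_ne hoy_ne]
      exact h₃xy
    obtain ⟨c₀, hc₀, hchamp₀⟩ := exists_champion (prodBernoulli w₀) A ⟨c, hc⟩ j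
    have hL₀ := ih w₀ hcount hoN₀ h₃zz₀ h₃off₀ h₃xy₀ c₀ hc₀ hchamp₀
    have hw₀e : w₀ s(o, v) = 0 := by simp [hw₀, he]
    have hMS := mergeStability_at_relay w₀ A o v c₀ j ho hvA hc₀ hw₀e hchamp₀
    have hw₁eq : Function.update w₀ s(o, v) 1 = w₁ := by
      rw [hw₀, hw₁, he, Function.update_idem]
    rw [hw₁eq] at hMS
    have hp0 : 0 ≤ (w e : ℝ) := (w e).2.1
    have hp1 : (w e : ℝ) ≤ 1 := (w e).2.2
    have hRc : (prodBernoulli w).real {ω : BondConfig (Fin n) | (A.filter fun z => ω ∈ openConn c₀ z).card ≤ j} ≤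
        (prodBernoulli w).real {ω : BondConfig (Fin n) | (A.filter fun z => ω ∈ openConn c z).card ≤ j} :=
      hchampw c₀ hc₀
    refine le_trans ?_ hRc
    rw [stub_oneBondDecomp_k15 n w e {ω : BondConfig (Fin n) |
        1 ≤ (A.filter fun z => ω ∈ openConn o z).card ∧ (A.filter fun z => ω ∈ openConn o z).card ≤ j},
      stub_oneBondDecomp_k15 n w e {ω : BondConfig (Fin n) |
        (A.filter fun z => ω ∈ openConn c₀ z).card ≤ j}]
    have h0 : (1 - (w e : ℝ)) * (prodBernoulli w₀).real {ω : BondConfig (Fin n) |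
          1 ≤ (A.filter fun z => ω ∈ openConn o z).card ∧ (A.filter fun z => ω ∈ openConn o z).card ≤ j} ≤
        (1 - (w e : ℝ)) * (prodBernoulli w₀).real {ω : BondConfig (Fin n) |
          (A.filter fun z => ω ∈ openConn c₀ z).card ≤ j} :=
      mul_le_mul_of_nonneg_left hL₀ (by linarith)
    have h1 : (w e : ℝ) * (prodBernoulli w₁).real {ω : BondConfig (Fin n) |
          1 ≤ (A.filter fun z => ω ∈ openConn o z).card ∧ (A.filter fun z => ω ∈ openConn o z).card ≤ j} ≤
        (w e : ℝ) * (prodBernoulli w₁).real {ω : BondConfig (Fin n) |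
          (A.filter fun z => ω ∈ openConn c₀ z).card ≤ j} :=
      mul_le_mul_of_nonneg_left hMS hp0
    exact add_le_add h0 h1



/-- **CIL for an observer with relay neighbours and two pendant relay-stars that may be joined to each other** (all
levels, every champion).  `o ∉ A`; `x ≠ y` non-relays `≠ o`; the positive-weight neighbours of `o` are relays, `x`, `y`;
those of `x` are relays, `o` and possibly `y`; those of `y` are relays, `o` and possibly `x`.  Then
`μ(1 ≤ |π(o)| ≤ j) ≤ μ(|π(c)| ≤ j)` for every champion `c` of `w`: `cil_twoSteiner_of` with the series-reduced graph written
out and `cil_oneSteiner` (prim-gen-swap) at `x` and at `y` there.  With `w s(x,y) = 0` this is `cil_twoSteiner`.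
[cite: KozmaNitzan2024, Thm 5 (p. 13) — CIL analogue for two Steiner neighbours] -/
theorem cil_twoSteiner_adj (w : Sym2 (Fin n) → unitInterval) (A : Finset (Fin n)) (o x y : Fin n) (j : ℕ)
    (ho : o ∉ A) (hx : x ∉ A) (hy : y ∉ A) (hxo : x ≠ o) (hyo : y ≠ o) (hxy : x ≠ y)
    (hoN : ∀ v : Fin n, v ≠ o → v ∉ A → v ≠ x → v ≠ y → (w s(o, v) : ℝ) = 0)
    (hxN : ∀ u : Fin n, u ≠ x → u ∉ A → u ≠ o → u ≠ y → (w s(x, u) : ℝ) = 0)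
    (hyN : ∀ u : Fin n, u ≠ y → u ∉ A → u ≠ o → u ≠ x → (w s(y, u) : ℝ) = 0)
    (c : Fin n) (hc : c ∈ A)
    (hchamp : ∀ a ∈ A,
      (prodBernoulli w).real {ω : BondConfig (Fin n) | (A.filter fun z => ω ∈ openConn a z).card ≤ j} ≤
        (prodBernoulli w).real {ω : BondConfig (Fin n) | (A.filter fun z => ω ∈ openConn c z).card ≤ j}) :
    (prodBernoulli w).real {ω : BondConfig (Fin n) |
        1 ≤ (A.filter fun z => ω ∈ openConn o z).card ∧ (A.filter fun z => ω ∈ openConn o z).card ≤ j} ≤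
      (prodBernoulli w).real {ω : BondConfig (Fin n) | (A.filter fun z => ω ∈ openConn c z).card ≤ j} := by
  have hox : o ≠ x := fun h => hxo h.symm
  have hoy : o ≠ y := fun h => hyo h.symm
  have hyx : y ≠ x := fun h => hxy h.symm
  -- the series-reduced graph, written out
  set w₃ : Sym2 (Fin n) → unitInterval := Function.update (pinW w {e : Sym2 (Fin n) | o ∈ e ∧ ¬ e.IsDiag} ∅) s(x, y)
    ⟨1 - (1 - (w s(x, y) : ℝ)) * (1 - (w s(o, x) : ℝ) * w s(o, y)), HullPort.seriesWeight_mem w o x y⟩ with hw₃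
  have hg_o : o ∉ s(x, y) := by
    rw [Sym2.mem_iff, not_or]; exact ⟨hox, hoy⟩
  have h₃z : ∀ v : Fin n, v ≠ o → w₃ s(o, v) = 0 := by
    intro v hv
    have hne : s(o, v) ≠ s(x, y) := fun h => hg_o (h ▸ Sym2.mem_mk_left o v)
    rw [hw₃, Function.update_of_ne hne]
    exact pinW_star_mk w hv
  have h₃zz : w₃ s(o, o) = w s(o, o) := by
    have hne : s(o, o) ≠ s(x, y) := fun h => hg_o (h ▸ Sym2.mem_mk_left o o)
    have hdiag : s(o, o) ∉ {e : Sym2 (Fin n) | o ∈ e ∧ ¬ e.IsDiag} := by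
      rintro ⟨-, h⟩; exact h (Sym2.mk_isDiag_iff.2 rfl)
    rw [hw₃, Function.update_of_ne hne, pinW_apply_of_not_mem w ∅ hdiag]
  have h₃off : ∀ e : Sym2 (Fin n), o ∉ e → e ≠ s(x, y) → w₃ e = w e := by
    intro e hoe hne
    have hmem : e ∉ {e : Sym2 (Fin n) | o ∈ e ∧ ¬ e.IsDiag} := fun h => hoe h.1
    rw [hw₃, Function.update_of_ne hne, pinW_apply_of_not_mem w ∅ hmem]
  have h₃xy : (w₃ s(x, y) : ℝ) = 1 - (1 - (w s(x, y) : ℝ)) * (1 - (w s(o, x) : ℝ) * w s(o, y)) := by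
    rw [hw₃, Function.update_self]
  -- neighbourhoods of `x` and `y` in `w₃`
  have hxN3 : ∀ v : Fin n, v ≠ x → v ∉ A → v ≠ y → (w₃ s(x, v) : ℝ) = 0 := by
    intro v hvx hvA hvy
    by_cases hvo : v = o
    · subst hvo; rw [Sym2.eq_swap, h₃z x hxo]; rfl
    · have hne : s(x, v) ≠ s(x, y) := fun h => hvy (Sym2.congr_right.1 h)
      have hoe : o ∉ s(x, v) := by
        rw [Sym2.mem_iff, not_or]; exact ⟨hox, fun h => hvo h.symm⟩
      rw [h₃off _ hoe hne]; exact hxN v hvx hvA hvo hvy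
  have hyN3 : ∀ u : Fin n, u ≠ y → u ∉ A → u ≠ x → (w₃ s(y, u) : ℝ) = 0 := by
    intro u huy huA hux
    by_cases huo : u = o
    · subst huo; rw [Sym2.eq_swap, h₃z y hyo]; rfl
    · have hne : s(y, u) ≠ s(x, y) := by
        rw [Sym2.eq_swap]; intro h; exact hux (Sym2.congr_left.1 h)
      have hoe : o ∉ s(y, u) := by
        rw [Sym2.mem_iff, not_or]; exact ⟨hoy, fun h => huo h.symm⟩
      rw [h₃off _ hoe hne]; exact hyN u huy huA huo hux
  refine cil_twoSteiner_of A o x y j ho hx hy hxo hyo hxy w₃ h₃z ?_ ?_ _ w rfl hoN h₃zz h₃off h₃xy c hc hchamp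
  · intro c' hc' hchamp'
    exact cil_oneSteiner w₃ A x y j hx hy hyx hxN3 hyN3 c' hc' hchamp'
  · intro c' hc' hchamp'
    have hyN3' : ∀ v : Fin n, v ≠ y → v ∉ A → v ≠ x → (w₃ s(y, v) : ℝ) = 0 := hyN3
    have hxN3' : ∀ u : Fin n, u ≠ x → u ∉ A → u ≠ y → (w₃ s(x, u) : ℝ) = 0 := hxN3
    exact cil_oneSteiner w₃ A y x j hy hx hxy hyN3' hxN3' c' hc' hchamp'

/-- **`cil_twoSteiner_adj` in the shape of the registered `stub_cumulativeIsolation`** (`∃ a ∈ A`, `A` nonempty). -/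
theorem cil_twoSteiner_adj_exists (w : Sym2 (Fin n) → unitInterval) (A : Finset (Fin n)) (o x y : Fin n) (j : ℕ)
    (hA : A.Nonempty) (ho : o ∉ A) (hx : x ∉ A) (hy : y ∉ A) (hxo : x ≠ o) (hyo : y ≠ o) (hxy : x ≠ y)
    (hoN : ∀ v : Fin n, v ≠ o → v ∉ A → v ≠ x → v ≠ y → (w s(o, v) : ℝ) = 0)
    (hxN : ∀ u : Fin n, u ≠ x → u ∉ A → u ≠ o → u ≠ y → (w s(x, u) : ℝ) = 0)
    (hyN : ∀ u : Fin n, u ≠ y → u ∉ A → u ≠ o → u ≠ x → (w s(y, u) : ℝ) = 0) :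
    ∃ a ∈ A, (prodBernoulli w).real {ω : BondConfig (Fin n) |
        1 ≤ (A.filter fun z => ω ∈ openConn o z).card ∧ (A.filter fun z => ω ∈ openConn o z).card ≤ j} ≤
      (prodBernoulli w).real {ω : BondConfig (Fin n) | (A.filter fun z => ω ∈ openConn a z).card ≤ j} := by
  obtain ⟨c, hc, hchamp⟩ := exists_champion (prodBernoulli w) A hA j
  exact ⟨c, hc, cil_twoSteiner_adj w A o x y j ho hx hy hxo hyo hxy hoN hxN hyN c hc hchamp⟩

end Summit.CriticalPhenomena.PercolationContinuityZ3.Theorems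

end
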